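import Mathlib
import HarnessLib
import Summits.ValiantsHypothesis.ValiantsHypothesis.Theorems.MonotoneRestorationOrbitRestorationQPValueDerivationSubst
import Summits.ValiantsHypothesis.ValiantsHypothesis.Theorems.MonotoneRestorationOrbitRestorationQPValueOrbitClosure
import Summits.ValiantsHypothesis.ValiantsHypothesis.Theorems.MonotoneRestorationOrbitRestorationQPValueOrbitRestoration

/-!
# Value derivations and quasi-polynomial orbit restorability are closed under EQUIVARIANT SUBSTITUTIONS with derivable values
(route MonotoneRestoration, crux `OrbitRestorationQP` stmt-ValiantsHypothesis-18293, line `depth-three-rung`, stub A_∞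
`stub_sigmaPiSigmaValue`; infrastructure of the value-orbit method)

Namespaces `Summit.ValiantsHypothesis.ValiantsHypothesis.Theorems.ValueDerivation` / `…ValueOrbit`.  Definition-free.

`…ValueDerivationSubst.lean` transports a value derivation along an equivariant AFFINE-DIAGONAL substitution `x ↦ w_x·x + a_x`.
Here the substitution `φ` is an arbitrary `K`-algebra endomorphism of `K[X]` commuting with the renamings `ren γ` (`γ ∈ Γ`), whose
values on the variables that occur are themselves values of a second derivation `𝒟₀` (the BASE): e.g. on the `n × n` matrix the
`Sym_n`-equivariant affine changes of variables `x_{ab} ↦ α x_{ab} + β R_a + γ C_b + δ U + ε` (row sums, column sums, total sum),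
or any equivariant polynomial substitution.  The image derivation has values `𝒟₀.S ∪ φ '' 𝒟.S`; a variable step of `𝒟` is
replaced by the base's derivation of `φ x`, every other step is mapped along `φ`; ranks of new values are least ranks of
preimages, stacked above the base.  Orbits do not grow (`ncard_orbit_map_le`).

* `exists_valueDerivation_subst_of_base` — **the transport theorem** (any field, any group of symmetries of the variables);
* `qpOrbitRestorable_subst` — **`QPOrbitRestorable c n p →` (`φ` equivariant for the diagonal action, every `φ x_{ab}` a value
  of a derivation with value orbits `≤ 2^((log₂ n + c)^c)`) `→ QPOrbitRestorable (c + 3) n (φ p)`** (flat cost `+3` of the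
  derivation-to-circuit conversion `ValueOrbit.qpOrbit_of_valueDerivation`).

Honest label: infrastructure (closure of the restorable class, hence of every landed stratum of A_∞, under equivariant
substitutions); no stub closed; VP ≠ VNP untouched. [folklore] [cite: DawarWilsenach2025, §3.3]
-/

noncomputable section

open scoped Classical

-- `Summit.ValiantsHypothesis.ValiantsHypothesis.…` is the tree's single-conjunct layout (Sub = Summit).
set_option linter.dupNamespace false

namespace Summit.ValiantsHypothesis.ValiantsHypothesis.Theorems

namespace ValueDerivation

universe u v w

variable {K : Type u} {X : Type v} [Field K]
variable {Γ : Type w} [Group Γ] [Fintype Γ] [MulAction Γ X]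

/-- **EQUIVARIANT SUBSTITUTION OF A VALUE DERIVATION OVER A BASE.**  Let `φ` be a `K`-algebra endomorphism of `K[X]` commuting
with the renamings `ren γ`, `γ ∈ Γ`, and let `𝒟₀` (the base) be a value derivation containing `φ x` for every variable `x` that is
a value of `𝒟`.  If all values of `𝒟₀` and of `𝒟` have `Γ`-orbits of size `≤ B`, then there is a value derivation containing every
value of `𝒟₀` and `φ p` for every value `p` of `𝒟`, all of whose values have `Γ`-orbits of size `≤ B`. [folklore] -/
theorem exists_valueDerivation_subst_of_base (φ : MvPolynomial X K →ₐ[K] MvPolynomial X K)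
    (hcomm : ∀ (γ : Γ) (q : MvPolynomial X K), ren γ (φ q) = φ (ren γ q))
    (𝒟₀ 𝒟 : ValueDerivation K X) (hbase : ∀ x : X, MvPolynomial.X x ∈ 𝒟.S → φ (MvPolynomial.X x) ∈ 𝒟₀.S) {B : ℕ}
    (hS₀ : ∀ q ∈ 𝒟₀.S, (Set.range fun γ : Γ => ren γ q).ncard ≤ B)
    (hS : ∀ q ∈ 𝒟.S, (Set.range fun γ : Γ => ren γ q).ncard ≤ B) :
    ∃ 𝒟' : ValueDerivation K X, (∀ q ∈ 𝒟₀.S, q ∈ 𝒟'.S) ∧ (∀ p ∈ 𝒟.S, φ p ∈ 𝒟'.S) ∧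
      (∀ q ∈ 𝒟'.S, q ∈ 𝒟₀.S ∨ ∃ p ∈ 𝒟.S, φ p = q) ∧
      ∀ q ∈ 𝒟'.S, (Set.range fun γ : Γ => ren γ q).ncard ≤ B := by
  -- the new values, and least ranks of preimages, stacked above the base
  set M := 𝒟₀.maxRank with hM
  let S' : Finset (MvPolynomial X K) := 𝒟₀.S ∪ 𝒟.S.image φ
  let pre : MvPolynomial X K → Set ℕ := fun r => {k | ∃ p ∈ 𝒟.S, φ p = r ∧ 𝒟.rank p = k}
  let rk : MvPolynomial X K → ℕ := fun r => if r ∈ 𝒟₀.S then 𝒟₀.rank r else M + 1 + sInf (pre r)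
  have hrk_S : ∀ {r}, r ∈ 𝒟₀.S → rk r = 𝒟₀.rank r := fun hr => by simp only [rk, if_pos hr]
  have hrk_le_of_S : ∀ {r}, r ∈ 𝒟₀.S → rk r ≤ M := fun hr => by rw [hrk_S hr]; exact 𝒟₀.rank_le_maxRank hr
  have hrk_img_le : ∀ {u}, u ∈ 𝒟.S → rk (φ u) ≤ M + 1 + 𝒟.rank u := by
    intro u hu
    by_cases h1 : φ u ∈ 𝒟₀.S
    · exact (hrk_le_of_S h1).trans (by omega)
    simp only [rk, if_neg h1]
    exact Nat.add_le_add_left (Nat.sInf_le (show 𝒟.rank u ∈ pre (φ u) from ⟨u, hu, rfl, rfl⟩)) _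
  have hrk_new : ∀ {r}, r ∉ 𝒟₀.S → rk r = M + 1 + sInf (pre r) := fun h1 => by
    simp only [rk, if_neg h1]
  -- membership helpers
  have memS' : ∀ {r}, r ∈ S' ↔ r ∈ 𝒟₀.S ∨ ∃ p ∈ 𝒟.S, φ p = r := by
    intro r
    simp only [S', Finset.mem_union, Finset.mem_image]
  have mem_of_S : ∀ {r}, r ∈ 𝒟₀.S → r ∈ S' := fun h => memS'.2 (Or.inl h)
  have img_mem : ∀ {p}, p ∈ 𝒟.S → φ p ∈ S' := fun h => memS'.2 (Or.inr ⟨_, h, rfl⟩)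
  refine ⟨⟨S', rk, ?_⟩, fun q hq => mem_of_S hq, fun p hp => img_mem hp, fun q hq => memS'.1 hq, ?_⟩
  · -- every new value has a valid step
    intro r hr
    by_cases h1 : r ∈ 𝒟₀.S
    · obtain ⟨d, hd⟩ := 𝒟₀.step r h1
      refine ⟨d, ⟨hd.value_eq, fun u hu => ?_⟩⟩
      obtain ⟨huS, hlt⟩ := hd.args_lt u hu
      exact ⟨mem_of_S huS, by rw [hrk_S huS, hrk_S h1]; exact hlt⟩
    -- `r = φ p` for a preimage `p` of least rank
    have hr' : ∃ p ∈ 𝒟.S, φ p = r := (memS'.1 hr).resolve_left h1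
    have hne : (pre r).Nonempty := by
      obtain ⟨p, hp, hpr⟩ := hr'
      exact ⟨_, p, hp, hpr, rfl⟩
    obtain ⟨p, hp, hpr, hprank⟩ := Nat.sInf_mem hne
    have hrk_r : rk r = M + 1 + 𝒟.rank p := by rw [hrk_new h1, hprank]
    -- operands of the image step: images of operands of `p`'s step have smaller rank
    have hops : ∀ u ∈ 𝒟.S, 𝒟.rank u < 𝒟.rank p → φ u ∈ S' ∧ rk (φ u) < rk r := fun u hu hlt =>
      ⟨img_mem hu, by rw [hrk_r]; exact (hrk_img_le hu).trans_lt (by omega)⟩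
    obtain ⟨d, hd⟩ := 𝒟.step p hp
    have hval := hd.value_eq
    cases d with
    | var x =>
      -- `p = x`, so `r = φ x` is a base value: excluded
      have hXp : MvPolynomial.X x = p := by rw [← hval]; rfl
      exact absurd (hpr ▸ hXp ▸ hbase x (hXp ▸ hp)) h1
    | const c =>
      refine ⟨StepData.const c, ⟨?_, fun u hu => ?_⟩⟩
      · rw [← hpr, ← hval]
        simp only [StepData.value, MvPolynomial.algHom_C, MvPolynomial.algebraMap_eq]
      · simp [StepData.args] at hu
    | sum D =>
      refine ⟨StepData.sum (D.map fun cu => (cu.1, φ cu.2)), ⟨?_, fun u hu => ?_⟩⟩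
      · rw [← hpr, ← hval]
        simp only [StepData.value, Multiset.map_map, Function.comp_def, map_multiset_sum, map_mul,
          MvPolynomial.algHom_C, MvPolynomial.algebraMap_eq]
      · simp only [StepData.args, Multiset.map_map, Function.comp_def, Multiset.mem_map] at hu
        obtain ⟨cu, hcu, rfl⟩ := hu
        have hmem : cu.2 ∈ (StepData.sum D : StepData K X).args := by
          simp only [StepData.args, Multiset.mem_map]
          exact ⟨cu, hcu, rfl⟩
        obtain ⟨huS, hlt⟩ := hd.args_lt cu.2 hmem
        exact hops cu.2 huS hlt
    | prod u₁ u₂ =>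
      refine ⟨StepData.prod (φ u₁) (φ u₂), ⟨?_, fun u hu => ?_⟩⟩
      · rw [← hpr, ← hval]
        simp only [StepData.value, map_mul]
      · simp only [StepData.args, Multiset.insert_eq_cons, Multiset.mem_cons,
          Multiset.mem_singleton] at hu
        have hm₁ : u₁ ∈ (StepData.prod u₁ u₂ : StepData K X).args := by simp [StepData.args]
        have hm₂ : u₂ ∈ (StepData.prod u₁ u₂ : StepData K X).args := by simp [StepData.args]
        rcases hu with rfl | rfl
        · obtain ⟨huS, hlt⟩ := hd.args_lt u₁ hm₁
          exact hops u₁ huS hlt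
        · obtain ⟨huS, hlt⟩ := hd.args_lt u₂ hm₂
          exact hops u₂ huS hlt
  · -- orbit bounds
    intro r hr
    rcases memS'.1 hr with h | ⟨p, hp, rfl⟩
    · exact hS₀ r h
    · exact (ncard_orbit_map_le φ hcomm p).trans (hS p hp)

end ValueDerivation

namespace ValueOrbit

open MvPolynomial Equiv Literature.Computability.AlgebraicComplexity OrbitRestorationQPDepthThreeRung

/-- **`QPOrbitRestorable` IS CLOSED UNDER EQUIVARIANT SUBSTITUTIONS WITH DERIVABLE VALUES** (cost `c ↦ c + 3`).  If `p` is
`QPOrbitRestorable c n p`, `φ` is a `ℂ`-algebra endomorphism of `ℂ[x_{ab}]` commuting with the diagonal action of `Sym (Fin n)`,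
and the values `φ x_{ab}` all lie in one value derivation whose values have orbits `≤ 2^((log₂ n + c)^c)`, then
`QPOrbitRestorable (c + 3) n (φ p)`. [folklore] -/
theorem qpOrbitRestorable_subst {c n : ℕ} {p : MvPolynomial (Fin n × Fin n) ℂ} (hp : QPOrbitRestorable c n p)
    (φ : MvPolynomial (Fin n × Fin n) ℂ →ₐ[ℂ] MvPolynomial (Fin n × Fin n) ℂ)
    (hcomm : ∀ (σ : Perm (Fin n)) (q : MvPolynomial (Fin n × Fin n) ℂ), ren σ (φ q) = φ (ren σ q))
    (𝒟₀ : ValueDerivation ℂ (Fin n × Fin n)) (hbase : ∀ x : Fin n × Fin n, φ (X x) ∈ 𝒟₀.S)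
    (hS₀ : ∀ q ∈ 𝒟₀.S, (Set.range fun σ : Perm (Fin n) => ren σ q).ncard ≤ 2 ^ ((Nat.log 2 n + c) ^ c)) :
    QPOrbitRestorable (c + 3) n (φ p) := by
  obtain ⟨hinv, 𝒟, hpS, hS⟩ := exists_valueDerivation_of_qpOrbitRestorable hp
  obtain ⟨𝒟', -, himg, -, hS'⟩ :=
    ValueDerivation.exists_valueDerivation_subst_of_base φ hcomm 𝒟₀ 𝒟 (fun x _ => hbase x) hS₀ hS
  have hfix : ∀ σ : Perm (Fin n), ren σ (φ p) = φ p := fun σ => by rw [hcomm, hinv σ]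
  exact qpOrbit_of_valueDerivation 𝒟' (himg p hpS) hfix hS'

end ValueOrbit

end Summit.ValiantsHypothesis.ValiantsHypothesis.Theorems

end
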